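import Summits.Langlands.Langlands.Theses.CMFreeCompletedClosure

/-!
# Birth skeleton (BC3) for crux stmt-Langlands-18473
`Summit.Langlands.Langlands.Theses.CMFreeCompletedClosure.AutomorphicPointCompatibility` — line `birth`

Route `route-Langlands-CMFreeCompletedClosure` (`closes : TotallyComplexReduction → TorsionGaloisRep →
Visibility → ProAutomorphy → DeRhamClassicality → AutomorphicPointCompatibility → TemperedPurity →
Langlands`).  The crux (C5, rank 5) says: for `E` totally complex, `n ≥ 1`, reciprocity data `R`,
assuming clause (B) of the summit in every rank `n' < n` over `E`: if `π` is L-algebraic cuspidal on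
`GL_n(𝔸_E)` and `ρ : Γ_E → GL_n(ℚ̄_ℓ)` is SEMISIMPLE and Satake–Frobenius compatible with `π` at
almost all places, then (i) `ρ` is irreducible, (ii) `ρ` is de Rham at every `v ∣ ℓ` (Fontaine's
pinned `D_pst` datum `R.pst ℓ v hv`), and (iii) at EVERY finite place `v` local–global compatibility
holds up to Frobenius-semisimplification (same characteristic polynomials on the Weil group as a
Frobenius-semisimple representative of `rec(π_v)`; Grothendieck–Deligne recipe at `v ∤ ℓ`, Fontaine
at `v ∣ ℓ`).

This file concludes the crux BY NAME from four named stubs, cut along the two seams the printed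
record itself draws — the PLACE (`v ∤ ℓ` versus `v ∣ ℓ`: A'Campo–Hevesi–Thorne–Whitmore 2026,
Conj. 1.1.3 (1)/(2), "the definition of the Weil–Deligne representation … depends, in the case
`v ∤ p`, on Grothendieck's `ℓ`-adic monodromy theorem … when `v ∣ p`, it is defined only under the
condition that `r_v` is de Rham", p. 4) and, above `ℓ`, DE RHAM-NESS versus COMPATIBILITY ("p-adic
limits of de Rham Galois representations of `G_{F_v}` need not be de Rham", p. 5 — the crux's
recorded risk, isolated as one stub) — plus the separate IRREDUCIBILITY clause, the only one that
consumes the induction hypothesis (B) in ranks `< n`: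

* `stub_lgcAwayFromEll` — (iii) at the places `v ∤ ℓ`: semisimplified local–global compatibility
  through the Grothendieck–Deligne recipe (`IsWeilDeligneOfLadic`).  KNOWN IN PRINT for REGULAR
  algebraic cuspidal `π` over CM `E` (Varma 2024, as reported in arXiv:2607.11763 p. 4: "if `v ∤ p`,
  then Varma proved that `r_{π,ι}` satisfies semi-simplified local–global compatibility at `v`");
  OPEN for irregular `π` and for non-CM totally complex `E` (no `r_{π,ι}` at all there).  No
  induction hypothesis.  Characteristic polynomials on `W_{E_v}` vary continuously in congruence
  families, which is why exactly this semisimplified form is what interpolation can give.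
* `stub_deRhamAboveEll` — (ii): `ρ` is de Rham at every `v ∣ ℓ`.  KNOWN for regular algebraic
  cuspidal `π` over CM `E` (arXiv:2607.11763 Thm. 1.2.1, first half); OPEN for irregular `π` — THE
  recorded risk of the crux ("ℓ-adic limits of de Rham representations need not be de Rham").
* `stub_pstCompatAboveEll` — (iii) at the places `v ∣ ℓ`, GIVEN de Rham-ness at `v`: semisimplified
  compatibility of the Weil–Deligne representation read off Fontaine's pinned datum
  (`(R.pst ℓ v hv).IsWeilDeligneOf`) with `rec(π_v)`.  KNOWN for regular algebraic cuspidal `π` over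
  CM `E` (arXiv:2607.11763 Thm. 1.2.1, second half: `WD(r_{π,ι}|_{G_{F_v}})^{ss} ≅
  ι⁻¹ rec^T_{F_v}(π_v)^{ss}`; earlier arXiv:2311.13514 / Hevesi under decomposed-generic and
  non-Eisenstein hypotheses); OPEN otherwise.
* `stub_irreducibleOfGeometric` — (i), GIVEN de Rham-ness above `ℓ` and clause (B) in ranks `< n`:
  a semisimple `ρ`, Satake–Frobenius compatible with a CUSPIDAL `π` almost everywhere and de Rham
  above `ℓ`, is irreducible.  Mechanism (the route's "irreducibility half of S-ind via
  Jacquet–Shalika"): a nontrivial decomposition `ρ = ρ₁ ⊕ ρ₂` has irreducible geometric summands of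
  ranks `< n` (sub-representations of an a.e.-unramified de Rham representation are such), (B) makes
  them cuspidal `π₁`, `π₂`, and then `L^S(s, π × π₁^∨) = L^S(s, π₁ × π₁^∨) · L^S(s, π₂ × π₁^∨)` would
  have a pole at the edge of convergence (Jacquet–Shalika 1981: pole of the diagonal pair
  `L`-function, non-vanishing of the off-diagonal one on the line) although `π ≇ π₁` have different
  ranks (Jacquet–Piatetski-Shapiro–Shalika: entire) — contradiction.  Plausibly XL over the tree's
  `partialPairL` / Jacquet–Shalika facts; unconditionally (without (B)) irreducibility of automorphic
  Galois representations is open beyond low rank even over CM fields.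

The composition `AutomorphicPointCompatibility_of` is kernel-checked and sorry-free: de Rham-ness
(stub 2) feeds both the irreducibility stub 4 and, place by place above `ℓ`, the compatibility stub 3;
at each finite `v` a classical `by_cases` on `ℓ ∈ v` selects stub 3 or stub 1, the other recipe's
clause of the crux being vacuous there (and Fontaine's datum `R.pst ℓ v hv` does not depend on the
proof `hv`: definitional proof irrelevance).  Pure logic — all mathematics sits in the stubs, none of
which is the crux: stub 1 lacks the places above `ℓ`, irreducibility and de Rham-ness; stub 2 is the
de Rham clause alone; stub 3 assumes de Rham-ness and speaks of one place; stub 4 assumes de Rham-ness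
and concludes irreducibility only.

Shape (for `ledger skeleton check`): each stub is `theorem stub_<name> : <Prop> := by sorry` (closed
statements over existing declarations only: the crux's own binders and clauses verbatim, re-cut);
`_Goal.stub_<name> : Prop := type_of% @stub_<name>` names that statement;
`AutomorphicPointCompatibility_of (h₁ : _Goal.stub_lgcAwayFromEll) (h₂ : _Goal.stub_deRhamAboveEll)
(h₃ : _Goal.stub_pstCompatAboveEll) (h₄ : _Goal.stub_irreducibleOfGeometric) :
Summit.Langlands.Langlands.Theses.CMFreeCompletedClosure.AutomorphicPointCompatibility` concludes the
route decl BY NAME; the last `example` feeds the four stubs to it.  Sorries: exactly 4, one inside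
each `stub_*`, none elsewhere.

BC3 AUDIT (registrar planner-skel-stmt-Langlands-18473-0, 2026-08-17; raw outputs in `Lines/birth.md`
and the registrar's NOTES.md): `lean check --json` on this file: rc 0, errors [], sorries 4 — exactly
the four `stub_*` declarations ("declaration uses sorry" at their lines), zero elsewhere;
`#print axioms AutomorphicPointCompatibility_of` = `[propext, Classical.choice, Quot.sound]` (no
`sorryAx`).  Probes (registrar's folder `bc/probe_S{1..4}.lean`, `bc/probe2_S{1..4}.lean`, stub
statements copied verbatim as `S1 … S4`): prescribed form `Sᵢ → AutomorphicPointCompatibility`,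
`Sᵢ → Langlands` by `first | exact? | simpa [Sᵢ] | (unfold Sᵢ; simpa) | aesop` under
`maxHeartbeats 400000` FAIL 8/8 (deterministic `whnf` timeouts); binders-first form (`unfold`,
`intro` the crux's / summit's binders, `first | exact? | aesop | simp_all`) FAIL 8/8 with honest
residual goals — against the crux: `IsIrreducible ρ.toGaloisRep` survives for S1/S2/S3, the de Rham
and compatibility clauses survive for S4; against the summit: `Nonempty (ReciprocityData F)` and
`GlobalLanglandsCorrespondenceGLn n F 𝓡 hcpt` survive for all four.  No stub is cheaply the crux or
the summit.  (The converse direction crux ⇒ S1/S2/S3 holds by design — they are clauses of the crux,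
re-cut by place — and crux ⇒ S4 as well; that is a decomposition, not a costume: no single stub gives
the crux (machine-checked above) and, by inspection, no three of the four do either.)

Disproof used: none exists — `ledger crux ls stmt-Langlands-18473` lists no workfiles (no
`Disproof.lean`, no `Negative/` lemma, no dead line, no crux ideas) at registration time; `ledger
negatives --problem Langlands` (4 entries: SplitPrimeInductionMonomialSerreAtSplitPrimes,
SplitPrimeInductionDeinduction, OrdinaryPrimeTransportRankinSelbergPoleCount,
K3KugaSatakeDescentSerreTypeAnchor) contains nothing of the shape of these stubs.  A previous
registration of this crux (planner-type-f53dacf04e-0, 3 stubs `stub_irreducible_at_cuspidal_points` /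
`stub_deRham_above_ell` / `stub_semisimple_lgc`, never published as a workfile) is refined here:
the irreducibility stub now ASSUMES de Rham-ness above `ℓ` (which its Jacquet–Shalika mechanism needs
to invoke (B) on the summands), and semisimplified compatibility is split by place as in print.
-/

set_option linter.dupNamespace false

noncomputable section

namespace Summit.Langlands.Langlands.Cruxes.AutomorphicPointCompatibility.Birth

-- the same `open`s as the route file (elaboration parity with the crux binders)
open scoped BigOperators Topology Manifold Classical MeasureTheory ProbabilityTheory Matrix InnerProductSpace ComplexConjugate ContinuousMap
open Filter Set Function TopologicalSpace MeasureTheory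

open Summit.Langlands.Langlands.Theses.CMFreeCompletedClosure

/-! ## 1. The four stubs -/

/-- **STUB 1 — semisimplified local–global compatibility AWAY from `ℓ`.**  For `E` totally complex,
`n ≥ 1`, reciprocity data `R`, `π` L-algebraic cuspidal on `GL_n(𝔸_E)`, `ℓ`, `ι`, and a SEMISIMPLE
framed `ρ : Γ_E → GL_n(ℚ̄_ℓ)` Satake–Frobenius compatible with `π` at almost all places: at every
finite `v ∤ ℓ` there are the local component `π_v` of `π`, a Weil–Deligne representation `r` attached
to `ρ|_{W_{E_v}}` by the Grothendieck–Deligne recipe (`IsWeilDeligneOfLadic`), its transport `rℂ`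
along `ι`, and a Frobenius-semisimple representative `r₀` of the class `rec_v(π_v)` such that `rℂ`
and `r₀` have the same characteristic polynomials on the Weil group (compatibility up to
semisimplification, A'Campo–Hevesi–Thorne–Whitmore Conj. 1.1.3 (1)).  Known for regular algebraic
`π` over CM `E` (Varma 2024, loc. cit. p. 4); open for irregular `π` / non-CM `E`.  Size: open
problem in general, XL transcription in the regular CM case.  Why it might fail: only with the crux
(a congruence-built `ρ` whose Weil-group traces at a ramified `v` do not interpolate those of
`rec(π_v)` — contradicting Langlands, not a proved theorem); normalisation slips (`rec^T` versus the
summit's `rec` on L-algebraic `π`) are the practical risk.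
[cite: arXiv:2607.11763, Conj. 1.1.3 and p. 4] [cite: HarrisTaylorAMS2001, Thm. A] -/
theorem stub_lgcAwayFromEll : ∀ (E : Type) [Field E] [NumberField E], NumberField.IsTotallyComplex E → ∀ (n : ℕ), 0 < n → ∀ (R : Summit.Langlands.ReciprocityData E) (hcpt : Literature.NumberTheory.Automorphic.isCompact_glFiniteIntegralLevel n E) (π : Literature.NumberTheory.Automorphic.CuspidalAutomorphicRepData n E hcpt), π.1.IsLAlgebraic → ∀ (ℓ : ℕ) [Fact ℓ.Prime] (ι : PadicAlgCl ℓ ≃+* ℂ) (ρ : Literature.NumberTheory.GaloisRepresentations.FramedGaloisRep E (PadicAlgCl ℓ) n), ρ.toGaloisRep.IsSemisimple → (∀ᶠ v : IsDedekindDomain.HeightOneSpectrum (NumberField.RingOfIntegers E) in Filter.cofinite, Summit.Langlands.SatakeFrobCompatibleAt ι π.1 ρ v) → ∀ (v : IsDedekindDomain.HeightOneSpectrum (NumberField.RingOfIntegers E)), ((ℓ : ℕ) : NumberField.RingOfIntegers E) ∉ v.asIdeal → ∃ (πv : Literature.NumberTheory.Automorphic.SmoothIrrep (Matrix.GeneralLinearGroup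 (Fin n) (v.adicCompletion E))) (r : Literature.NumberTheory.GaloisRepresentations.WeilDeligneRep (v.adicCompletion E) (PadicAlgCl ℓ) (Fin n → PadicAlgCl ℓ)) (rℂ r₀ : Literature.NumberTheory.GaloisRepresentations.WeilDeligneRep (v.adicCompletion E) ℂ (Fin n → ℂ)) (h₀ : r₀.IsFrobSemisimple), π.1.HasLocalComponentAt v πv.ρ ∧ Literature.NumberTheory.GaloisRepresentations.IsWeilDeligneOfLadic (ρ.toLocal v).toWeilGroupHom r ∧ r.IsTransportAlong (ι : PadicAlgCl ℓ →+* ℂ) rℂ ∧ Quotient.mk (Literature.NumberTheory.Automorphic.frobSemisimpleWDSetoid (v.adicCompletion E) n) ⟨r₀, h₀⟩ = (R.llc v).recGL n (Literature.NumberTheory.Automorphic.IrrClass.mk πv) ∧ ∀ w : Literature.NumberTheory.GaloisRepresentations.WeilGroup (v.adicCompletion E), (LinearMap.toMatrix' (rℂ.ρ w)).charpoly = (LinearMap.toMatrix' (r₀.ρ w)).charpoly := by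
  sorry

/-- **STUB 2 — de Rham above `ℓ` (the recorded risk, isolated).**  In the same setting (no
induction hypothesis): `ρ|_{Γ_{E_v}}` is de Rham at every `v ∣ ℓ`, relative to Fontaine's pinned
datum (`(R.pst ℓ v hv).IsDeRhamFramed (ρ.toLocal v)`).  Known for regular algebraic cuspidal `π`
over CM `E` (arXiv:2607.11763 Thm. 1.2.1: "`r_{π,ι}|_{G_{F_v}}` is de Rham of Hodge–Tate weights
…", via potentially semistable pseudodeformation rings, §3); OPEN for irregular `π`: "p-adic limits
of de Rham Galois representations of `G_{F_v}` need not be de Rham" (p. 5).  Size: open problem.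
Why it might fail: an irregular (limit of discrete series at ∞) `π` whose interpolated `ρ` is
Hodge–Tate but not de Rham at some `v ∣ ℓ` would refute it — no such example is known and
Fontaine–Mazur–Langlands forbids it.
[cite: arXiv:2607.11763, Thm. 1.2.1 and p. 5] [cite: FontaineMazurGeometric1995, Conj. 1] -/
theorem stub_deRhamAboveEll : ∀ (E : Type) [Field E] [NumberField E], NumberField.IsTotallyComplex E → ∀ (n : ℕ), 0 < n → ∀ (R : Summit.Langlands.ReciprocityData E) (hcpt : Literature.NumberTheory.Automorphic.isCompact_glFiniteIntegralLevel n E) (π : Literature.NumberTheory.Automorphic.CuspidalAutomorphicRepData n E hcpt), π.1.IsLAlgebraic → ∀ (ℓ : ℕ) [Fact ℓ.Prime] (ι : PadicAlgCl ℓ ≃+* ℂ) (ρ : Literature.NumberTheory.GaloisRepresentations.FramedGaloisRep E (PadicAlgCl ℓ) n), ρ.toGaloisRep.IsSemisimple → (∀ᶠ v : IsDedekindDomain.HeightOneSpectrum (NumberField.RingOfIntegers E) in Filter.cofinite, Summit.Langlands.SatakeFrobCompatibleAt ι π.1 ρ v) → ∀ (v : IsDedekindDomain.HeightOneSpectrum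 (NumberField.RingOfIntegers E)) (hv : ((ℓ : ℕ) : NumberField.RingOfIntegers E) ∈ v.asIdeal), (R.pst ℓ v hv).IsDeRhamFramed (ρ.toLocal v) := by
  sorry

/-- **STUB 3 — semisimplified compatibility AT `ℓ`, given de Rham-ness.**  In the same setting, at a
place `v ∣ ℓ` where `ρ|_{Γ_{E_v}}` IS de Rham (hypothesis): there are the local component `π_v`, a
Weil–Deligne representation `r` attached to `ρ|_{Γ_{E_v}}` through Fontaine's pinned `D_pst` datum
(`(R.pst ℓ v hv).IsWeilDeligneOf (ρ.toLocal v) r`; it exists because `ρ|_v` is de Rham —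
`IsDeRhamFramed.exists_isWeilDeligneOf`), its transport `rℂ` along `ι`, and a Frobenius-semisimple
representative `r₀` of `rec_v(π_v)` with the same characteristic polynomials on `W_{E_v}`
(A'Campo–Hevesi–Thorne–Whitmore Conj. 1.1.3 (2), semisimplified form).  Known for regular algebraic
cuspidal `π` over CM `E` (arXiv:2607.11763 Thm. 1.2.1, second half; arXiv:2311.13514 under
decomposed-generic / non-Eisenstein hypotheses); open otherwise.  Size: open problem in general, XL
transcription in the regular CM case.  Why it might fail: as stub 1, plus the Hodge–Tate-weight
bookkeeping hidden in `rec(π_v)` at `v ∣ ℓ` for irregular `π`.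
[cite: arXiv:2607.11763, Thm. 1.2.1] [cite: arXiv:2311.13514] [cite: FontaineAsterisque223VIII, §2.3.7] -/
theorem stub_pstCompatAboveEll : ∀ (E : Type) [Field E] [NumberField E], NumberField.IsTotallyComplex E → ∀ (n : ℕ), 0 < n → ∀ (R : Summit.Langlands.ReciprocityData E) (hcpt : Literature.NumberTheory.Automorphic.isCompact_glFiniteIntegralLevel n E) (π : Literature.NumberTheory.Automorphic.CuspidalAutomorphicRepData n E hcpt), π.1.IsLAlgebraic → ∀ (ℓ : ℕ) [Fact ℓ.Prime] (ι : PadicAlgCl ℓ ≃+* ℂ) (ρ : Literature.NumberTheory.GaloisRepresentations.FramedGaloisRep E (PadicAlgCl ℓ) n), ρ.toGaloisRep.IsSemisimple → (∀ᶠ v : IsDedekindDomain.HeightOneSpectrum (NumberField.RingOfIntegers E) in Filter.cofinite, Summit.Langlands.SatakeFrobCompatibleAt ι π.1 ρ v) → ∀ (v : IsDedekindDomain.HeightOneSpectrum (NumberField.RingOfIntegers E)) (hv : ((ℓ : ℕ) : NumberField.RingOfIntegers E) ∈ v.asIdeal), (R.pst ℓ v hv).IsDeRhamFramed (ρ.toLocal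 v) → ∃ (πv : Literature.NumberTheory.Automorphic.SmoothIrrep (Matrix.GeneralLinearGroup (Fin n) (v.adicCompletion E))) (r : Literature.NumberTheory.GaloisRepresentations.WeilDeligneRep (v.adicCompletion E) (PadicAlgCl ℓ) (Fin n → PadicAlgCl ℓ)) (rℂ r₀ : Literature.NumberTheory.GaloisRepresentations.WeilDeligneRep (v.adicCompletion E) ℂ (Fin n → ℂ)) (h₀ : r₀.IsFrobSemisimple), π.1.HasLocalComponentAt v πv.ρ ∧ (R.pst ℓ v hv).IsWeilDeligneOf (ρ.toLocal v) r ∧ r.IsTransportAlong (ι : PadicAlgCl ℓ →+* ℂ) rℂ ∧ Quotient.mk (Literature.NumberTheory.Automorphic.frobSemisimpleWDSetoid (v.adicCompletion E) n) ⟨r₀, h₀⟩ = (R.llc v).recGL n (Literature.NumberTheory.Automorphic.IrrClass.mk πv) ∧ ∀ w : Literature.NumberTheory.GaloisRepresentations.WeilGroup (v.adicCompletion E), (LinearMap.toMatrix' (rℂ.ρ w)).charpoly = (LinearMap.toMatrix' (r₀.ρ w)).charpoly := by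
  sorry

/-- **STUB 4 — irreducibility, given de Rham-ness above `ℓ` and reciprocity (B) in ranks `< n`.**
For `E` totally complex, `n ≥ 1`, `R`, ASSUMING clause (B) of the summit (`GaloisToAutomorphic`) in
every rank `n' < n` over `E`: if `π` is L-algebraic cuspidal, `ρ` is semisimple, Satake–Frobenius
compatible with `π` almost everywhere, and de Rham at every `v ∣ ℓ`, then `ρ` is irreducible.
Mechanism: were `ρ = ρ₁ ⊕ ρ₂` nontrivially, the summands are irreducible (refine), a.e. unramified and
de Rham (heredity of admissibility), of ranks `0 < nᵢ < n`, hence by (B) correspond to cuspidal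
L-algebraic `πᵢ`; the Satake parameters of `π` and of `π₁ ⊞ π₂` then agree almost everywhere, and
Jacquet–Shalika (pole of `L^S(s, π₁ × π₁^∨)`, non-vanishing of `L^S(s, π₂ × π₁^∨)` on the line,
holomorphy of `L^S(s, π × π₁^∨)` for cuspidal `π ≇ π₁`) gives the contradiction.  Size: XL over the
tree's Rankin–Selberg facts (`partialPairL`, `JacquetShalika1981_…`).  Why it might fail: only
through the heredity step in the tree's abstract admissibility formalism (`PeriodRingData`: stability
of `𝔅`-admissible representations under sub-objects must be available or added as Fontaine's named
fact, Exp. III Prop. 1.5.2) or an L- versus unitary-normalisation slip in the pair `L`-function argument.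
[cite: JacquetShalikaEulerProductsII1981, Thm. 4.4] [cite: FontaineAsterisque223III, §1.5]
[cite: BuzzardGeeLMS2014, Conj. 3.2.2] -/
theorem stub_irreducibleOfGeometric : ∀ (E : Type) [Field E] [NumberField E], NumberField.IsTotallyComplex E → ∀ (n : ℕ), 0 < n → ∀ (R : Summit.Langlands.ReciprocityData E), (∀ n' < n, 0 < n' → ∀ hcpt' : Literature.NumberTheory.Automorphic.isCompact_glFiniteIntegralLevel n' E, Summit.Langlands.GaloisToAutomorphic n' R hcpt') → ∀ (hcpt : Literature.NumberTheory.Automorphic.isCompact_glFiniteIntegralLevel n E) (π : Literature.NumberTheory.Automorphic.CuspidalAutomorphicRepData n E hcpt), π.1.IsLAlgebraic → ∀ (ℓ : ℕ) [Fact ℓ.Prime] (ι : PadicAlgCl ℓ ≃+* ℂ) (ρ : Literature.NumberTheory.GaloisRepresentations.FramedGaloisRep E (PadicAlgCl ℓ) n), ρ.toGaloisRep.IsSemisimple → (∀ᶠ v : IsDedekindDomain.HeightOneSpectrum (NumberField.RingOfIntegers E) in Filter.cofinite, Summit.Langlands.SatakeFrobCompatibleAt ι π.1 ρ v) → (∀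 (v : IsDedekindDomain.HeightOneSpectrum (NumberField.RingOfIntegers E)) (hv : ((ℓ : ℕ) : NumberField.RingOfIntegers E) ∈ v.asIdeal), (R.pst ℓ v hv).IsDeRhamFramed (ρ.toLocal v)) → ρ.toGaloisRep.IsIrreducible := by
  sorry

/-! ## 2. The stub statements as named propositions (the composition's hypotheses, by name)

`_Goal` is internal on purpose: audits listing the file's declarations by short name find the `stub_*`
THEOREMS, while the skeleton check accepts the hypotheses of `AutomorphicPointCompatibility_of` by the
stub names they carry.  Each `_Goal.stub_x` is `type_of% @stub_x` — no text duplicated, no `sorry`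
inherited (a type, not a proof). -/

namespace _Goal

/-- The statement of `stub_lgcAwayFromEll`, as a named `Prop` (literally its type). [folklore] -/
def stub_lgcAwayFromEll : Prop :=
  type_of% @Summit.Langlands.Langlands.Cruxes.AutomorphicPointCompatibility.Birth.stub_lgcAwayFromEll

/-- The statement of `stub_deRhamAboveEll`, as a named `Prop` (literally its type). [folklore] -/
def stub_deRhamAboveEll : Prop :=
  type_of% @Summit.Langlands.Langlands.Cruxes.AutomorphicPointCompatibility.Birth.stub_deRhamAboveEll

/-- The statement of `stub_pstCompatAboveEll`, as a named `Prop` (literally its type). [folklore] -/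
def stub_pstCompatAboveEll : Prop :=
  type_of% @Summit.Langlands.Langlands.Cruxes.AutomorphicPointCompatibility.Birth.stub_pstCompatAboveEll

/-- The statement of `stub_irreducibleOfGeometric`, as a named `Prop` (literally its type).
[folklore] -/
def stub_irreducibleOfGeometric : Prop :=
  type_of% @Summit.Langlands.Langlands.Cruxes.AutomorphicPointCompatibility.Birth.stub_irreducibleOfGeometric

end _Goal

/-! ## 3. The composition (kernel-checked, no `sorry`) -/

/-- **`AutomorphicPointCompatibility` from the four stubs.**  De Rham-ness above `ℓ` (stub 2) is
established first and handed to the irreducibility stub 4 (together with the induction hypothesis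
(B) in ranks `< n`) and, at each `v ∣ ℓ`, to the compatibility stub 3; at `v ∤ ℓ` stub 1 applies.
In either case the clause of the crux belonging to the other recipe is vacuous (`ℓ ∈ v` is
decidable classically), and the Fontaine datum `R.pst ℓ v hv` is insensitive to the proof `hv`.
The hypotheses are, by name, the statements of `stub_lgcAwayFromEll`, `stub_deRhamAboveEll`,
`stub_pstCompatAboveEll`, `stub_irreducibleOfGeometric`; the conclusion is the route decl.
[folklore] -/
theorem AutomorphicPointCompatibility_of (h₁ : _Goal.stub_lgcAwayFromEll)
    (h₂ : _Goal.stub_deRhamAboveEll) (h₃ : _Goal.stub_pstCompatAboveEll)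
    (h₄ : _Goal.stub_irreducibleOfGeometric) :
    Summit.Langlands.Langlands.Theses.CMFreeCompletedClosure.AutomorphicPointCompatibility := by
  unfold _Goal.stub_lgcAwayFromEll at h₁
  unfold _Goal.stub_deRhamAboveEll at h₂
  unfold _Goal.stub_pstCompatAboveEll at h₃
  unfold _Goal.stub_irreducibleOfGeometric at h₄
  intro E _ _ hE n hn R ihB hcpt π hπ ℓ _ ι ρ hss hae
  -- (ii) de Rham above `ℓ`, once and for all
  have hdR : ∀ (v : IsDedekindDomain.HeightOneSpectrum (NumberField.RingOfIntegers E))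
      (hv : ((ℓ : ℕ) : NumberField.RingOfIntegers E) ∈ v.asIdeal),
      (R.pst ℓ v hv).IsDeRhamFramed (ρ.toLocal v) :=
    h₂ E hE n hn R hcpt π hπ ℓ ι ρ hss hae
  refine ⟨h₄ E hE n hn R ihB hcpt π hπ ℓ ι ρ hss hae hdR, hdR, fun v => ?_⟩
  by_cases hv : ((ℓ : ℕ) : NumberField.RingOfIntegers E) ∈ v.asIdeal
  · -- `v ∣ ℓ`: Fontaine's recipe (stub 3, fed the de Rham-ness of stub 2); the `v ∤ ℓ` clause is vacuous
    obtain ⟨πv, r, rℂ, r₀, h₀, hloc, hwd, htr, hrec, hcp⟩ :=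
      h₃ E hE n hn R hcpt π hπ ℓ ι ρ hss hae v hv (hdR v hv)
    exact ⟨πv, r, rℂ, r₀, h₀, hloc, fun h => absurd hv h, fun _ => hwd, htr, hrec, hcp⟩
  · -- `v ∤ ℓ`: the Grothendieck–Deligne recipe (stub 1); the `v ∣ ℓ` clause is vacuous
    obtain ⟨πv, r, rℂ, r₀, h₀, hloc, hwd, htr, hrec, hcp⟩ :=
      h₁ E hE n hn R hcpt π hπ ℓ ι ρ hss hae v hv
    exact ⟨πv, r, rℂ, r₀, h₀, hloc, fun _ => hwd, fun hv' => absurd hv' hv, htr, hrec, hcp⟩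

/-- By-name sanity check (an `example`, not a declaration of the file): the four stubs feed the
composition as they stand. -/
example : Summit.Langlands.Langlands.Theses.CMFreeCompletedClosure.AutomorphicPointCompatibility :=
  AutomorphicPointCompatibility_of stub_lgcAwayFromEll stub_deRhamAboveEll stub_pstCompatAboveEll
    stub_irreducibleOfGeometric

end Summit.Langlands.Langlands.Cruxes.AutomorphicPointCompatibility.Birth

end
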